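import Summits.NavierStokesRegularity.NavierStokesRegularity.Theorems.SymmetricScarExists.Negative.LoadBearingSingularAntecedent
import Summits.NavierStokesRegularity.NavierStokesRegularity.Theorems.SymmetricScarExists.Negative.SpiralField
import Literature.Analysis.FluidPDE.KinematicApexWitness

/-!
# `SymmetricScarExists` (crux stmt-NavierStokesRegularity-11718, route RellichScar): which conjuncts
# of the CONCLUSION are load-bearing — negative-side support, part 6 (cdisprove seat, gen 3)

The crux is `∀ C, ApexSingular C → ∃ C' u p G, SWS ∧ WG ∧ 𝐈 < ⊤ ∧ Decay C' ∧ Singular ∧ (HomScar ∨ AxiScar)`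
(`SWS` = suitable weak solution of Navier–Stokes on the slab `ℝ³ × (−∞,0)`, `WG` = weak spatial gradient,
`𝐈` = Albritton–Barker's Type-I quantity, `Decay C'` = the space–time bound `|u| ≤ C'/(|x|+√−t)`,
`Singular` = backward-singular origin).  Part 4 (`LoadBearingSingularAntecedent`) showed that the
singularity of the ANTECEDENT is load-bearing.  Here the conclusion is dissected:

* `symmetricScarExists_without_singularConclusion` — drop `Singular` from the conclusion only: the
  statement becomes TRUE outright, witnessed by the ZERO FLOW (a suitable weak solution with `𝐈 = 0`,
  decay constant `0`, and both scar symmetries: `homScar_zero`, `axiScar_zero`);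
* `symmetricScarExists_without_navierStokesConclusion` — drop ONLY the Navier–Stokes membership `SWS`
  from the conclusion, keeping the weak gradient, `𝐈 < ⊤` (pressure `0`), the decay (constant `3`), the
  singular origin and the scar symmetry: TRUE outright, witnessed by the sibling disprover's KINEMATIC
  PARABOLIC BUMP `χ(|x|²/(−t))/√(−t) e₁` (`Literature.Analysis.FluidPDE.ParabolicBump.apexVelocity`,
  `KinematicApexWitness.lean`).  The bump is exactly self-similar (`nsRescale_apexVelocity_of_neg`) and —
  the real point — its support shrinks into the origin (`eventuallyInsideBalls_apexVelocity`), so its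
  scar is ZERO and it has BOTH a homogeneous and an axisymmetric scar (`homScar_apexVelocity`,
  `axiScar_apexVelocity`; general mechanism `sameScar_of_eventuallyInsideBalls`: fields supported in
  `‖x‖ < ρ(t) → 0` have the same (zero) scar, and the class is stable under rescaling and rotation);
* `noMildScar_false_without_navierStokes` — the same bump, with `σ = 0 ∈ L³`, shows that the sibling
  support `NoMildScar` (stmt-11723) is FALSE with its Navier–Stokes hypothesis dropped: a zero (hence
  mild) scar is kinematically compatible with `WG ∧ 𝐈 < ⊤ ∧ Decay ∧ Singular`; only the equations (ESS
  backward uniqueness) can exclude it;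
* `symmetricScarExistsWithoutDecayConclusion_iff_of_not_localTypeISingularityExists` — by contrast the
  decay constant of the conclusion is NOT load-bearing relative to the (L)-world: with `Decay C'`
  dropped from the conclusion the statement still asserts, when instantiated, a local Type-I singularity
  (`localTypeISingularityExists_of_withoutDecayConclusion`), so under `¬ LocalTypeISingularityExists`
  it is equivalent to the crux (both hold vacuously).

Upshot for provers/planners: the conclusion of the crux is non-trivial exactly through the conjunction
"Navier–Stokes ∧ singular" — the same perimeter as the antecedent (part 1, `LocalTypeIBarrier`:
`SWS ∧ WG ∧ 𝐈 < ⊤ ∧ Singular` is a witness of `LocalTypeISingularityExists`).  Every other conjunct of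
the conclusion (weak gradient, `𝐈 < ⊤`, the Type-I envelope, and the scar symmetry itself — even BOTH
symmetries at once) is kinematically consistent.

## References

* D. Albritton, T. Barker, J. Math. Fluid Mech. 21 (2019) = arXiv:1811.00502, §1, Thm 1.1. [AlbrittonBarker2019]
* G. Koch, N. Nadirashvili, G. Seregin, V. Šverák, Acta Math. 203 (2009), (1.6). [KNSS2009]
* L. Escauriaza, G. Seregin, V. Šverák, Russ. Math. Surveys 58 (2003), Thm 1 (zero scar ⇒ zero
  vorticity on the exterior: the mechanism `NoMildScar` must invoke). [EscauriazaSereginSverak2003]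
-/

noncomputable section

open MeasureTheory Set Function Filter Topology TopologicalSpace Metric
open scoped NNReal ENNReal

namespace Summit.NavierStokesRegularity.NavierStokesRegularity.Theorems.SymmetricScarExists.Negative

open Literature.Analysis.FluidPDE
open Summit.NavierStokesRegularity.NavierStokesRegularity.Theses.RellichScar

section ConclusionLoadBearing

variable {f g : ℝ → (EuclideanSpace ℝ (Fin 3)) → (EuclideanSpace ℝ (Fin 3))}

/-! ### Zero scars: fields whose support shrinks into the origin -/

/-- The support of `f(t, ·)` shrinks into the origin as `t ↑ 0`: for every `ρ > 0` there is `δ₀ > 0`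
with `f(t, x) = 0` whenever `−δ₀ < t < 0` and `‖x‖ ≥ ρ`.  (The kinematic bump has this with
`δ₀ = ρ²/2`; so has every field supported in the paraboloid `‖x‖ ≤ c√−t`.) [folklore] -/
def EventuallyInsideBalls (f : ℝ → (EuclideanSpace ℝ (Fin 3)) → (EuclideanSpace ℝ (Fin 3))) : Prop :=
  ∀ ρ : ℝ, 0 < ρ → ∃ δ₀ : ℝ, 0 < δ₀ ∧ ∀ t ∈ Ioo (-δ₀) 0, ∀ x : EuclideanSpace ℝ (Fin 3), ρ ≤ ‖x‖ → f t x = 0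

/-- A compact set avoiding the origin keeps a positive distance from it. [folklore] -/
theorem exists_pos_le_norm_of_isCompact {K : Set (EuclideanSpace ℝ (Fin 3))} (hK : IsCompact K)
    (h0 : (0 : EuclideanSpace ℝ (Fin 3)) ∉ K) : ∃ ρ : ℝ, 0 < ρ ∧ ∀ x ∈ K, ρ ≤ ‖x‖ := by
  have hopen : IsOpen Kᶜ := hK.isClosed.isOpen_compl
  obtain ⟨ρ, hρ, hball⟩ := Metric.isOpen_iff.1 hopen 0 (mem_compl h0)
  refine ⟨ρ, hρ, fun x hx => ?_⟩
  by_contra hlt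
  push Not at hlt
  exact hball (by simpa using hlt) hx

/-- **Two fields whose supports shrink into the origin have the same (zero) scar**: on
`(−δ, 0) × K`, `K` compact `∌ 0`, both vanish identically once `δ` is small, so the essential
supremum of the difference is eventually `0`. [folklore] -/
theorem sameScar_of_eventuallyInsideBalls (hf : EventuallyInsideBalls f) (hg : EventuallyInsideBalls g) :
    SameScar f g := by
  intro K hK h0
  obtain ⟨ρ, hρ, hKρ⟩ := exists_pos_le_norm_of_isCompact hK h0
  obtain ⟨δf, hδf, hf0⟩ := hf ρ hρ
  obtain ⟨δg, hδg, hg0⟩ := hg ρ hρ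
  have hδ : 0 < min δf δg := lt_min hδf hδg
  have hzero : ∀ δ ∈ Ioo (0 : ℝ) (min δf δg),
      eLpNorm (uncurry f - uncurry g) ⊤ (volume.restrict (Ioo (-δ) 0 ×ˢ K)) = 0 := by
    intro δ hδ'
    have hae : (uncurry f - uncurry g) =ᵐ[volume.restrict (Ioo (-δ) 0 ×ˢ K)] 0 := by
      filter_upwards [ae_restrict_mem (measurableSet_Ioo.prod hK.measurableSet)] with z hz
      obtain ⟨⟨hz1, hz2⟩, hzK⟩ := hz
      have htf : z.1 ∈ Ioo (-δf) 0 := ⟨by linarith [hδ'.2, min_le_left δf δg], hz2⟩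
      have htg : z.1 ∈ Ioo (-δg) 0 := ⟨by linarith [hδ'.2, min_le_right δf δg], hz2⟩
      simp only [Pi.sub_apply, uncurry, Pi.zero_apply]
      rw [hf0 z.1 htf z.2 (hKρ z.2 hzK), hg0 z.1 htg z.2 (hKρ z.2 hzK), sub_zero]
    rw [eLpNorm_congr_ae hae, eLpNorm_zero]
  refine Tendsto.congr' ?_ tendsto_const_nhds
  filter_upwards [Ioo_mem_nhdsGT hδ] with δ hδ'
  exact (hzero δ hδ').symm

/-- The class is stable under the Navier–Stokes rescaling (`λ > 0`). [folklore] -/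
theorem EventuallyInsideBalls.rescale (hf : EventuallyInsideBalls f) {lam : ℝ} (hlam : 0 < lam) :
    EventuallyInsideBalls (nsRescale lam f) := by
  intro ρ hρ
  obtain ⟨δ₀, hδ₀, h0⟩ := hf (lam * ρ) (by positivity)
  refine ⟨δ₀ / lam ^ 2, by positivity, fun t ht x hx => ?_⟩
  rw [nsRescale_apply]
  have ht' : lam ^ 2 * t ∈ Ioo (-δ₀) 0 := by
    obtain ⟨ht1, ht2⟩ := ht
    have hl2 : (0 : ℝ) < lam ^ 2 := by positivity
    constructor
    · have := mul_lt_mul_of_pos_left ht1 hl2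
      rwa [show lam ^ 2 * (-(δ₀ / lam ^ 2)) = -δ₀ by field_simp] at this
    · exact mul_neg_of_pos_of_neg hl2 ht2
  have hx' : lam * ρ ≤ ‖lam • x‖ := by
    rw [norm_smul, Real.norm_of_nonneg hlam.le]
    exact mul_le_mul_of_nonneg_left hx hlam.le
  rw [h0 _ ht' _ hx', smul_zero]

/-- The class is stable under rotation-conjugation about the `x₃`-axis. [folklore] -/
theorem EventuallyInsideBalls.rotate (hf : EventuallyInsideBalls f) (θ : ℝ) :
    EventuallyInsideBalls (conjZ θ f) := by
  intro ρ hρ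
  obtain ⟨δ₀, hδ₀, h0⟩ := hf ρ hρ
  refine ⟨δ₀, hδ₀, fun t ht x hx => ?_⟩
  simp only [conjZ]
  rw [h0 t ht (rotZ (-θ) x) (by rwa [norm_rotZ]), rotZ_zero_vec']

/-- Hence such a field has a HOMOGENEOUS scar … [folklore] -/
theorem homScar_of_eventuallyInsideBalls (hf : EventuallyInsideBalls f) : HomScar f :=
  fun _ hlam => sameScar_of_eventuallyInsideBalls (hf.rescale hlam) hf

/-- … and an AXISYMMETRIC scar. [folklore] -/
theorem axiScar_of_eventuallyInsideBalls (hf : EventuallyInsideBalls f) : AxiScar f :=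
  fun θ => sameScar_of_eventuallyInsideBalls (hf.rotate θ) hf

/-! ### (a) The singularity of the conclusion -/

/-- The crux with `IsBackwardSingularPoint u 0` dropped from the CONCLUSION only. -/
def SymmetricScarExistsWithoutSingularConclusion : Prop :=
  ∀ C : ℝ, (∃ (u : ℝ → (EuclideanSpace ℝ (Fin 3)) → (EuclideanSpace ℝ (Fin 3))) (p : ℝ → (EuclideanSpace ℝ (Fin 3)) → ℝ) (G : ℝ → (EuclideanSpace ℝ (Fin 3)) → (EuclideanSpace ℝ (Fin 3)) →L[ℝ] (EuclideanSpace ℝ (Fin 3))),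
      IsSuitableWeakSolutionOn (slab (EuclideanSpace ℝ (Fin 3)) (Iio (0 : ℝ)) isOpen_Iio) 1 0 u p ∧ HasWeakSpatialGradientOn (slab (EuclideanSpace ℝ (Fin 3)) (Iio (0 : ℝ)) isOpen_Iio) u G ∧
      typeIBound (Iio (0 : ℝ) ×ˢ univ) u p G < ⊤ ∧ HasTypeIDecay C u ∧ IsBackwardSingularPoint u 0) →
    ∃ (C' : ℝ) (u : ℝ → (EuclideanSpace ℝ (Fin 3)) → (EuclideanSpace ℝ (Fin 3))) (p : ℝ → (EuclideanSpace ℝ (Fin 3)) → ℝ) (G : ℝ → (EuclideanSpace ℝ (Fin 3)) → (EuclideanSpace ℝ (Fin 3)) →L[ℝ] (EuclideanSpace ℝ (Fin 3))),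
      IsSuitableWeakSolutionOn (slab (EuclideanSpace ℝ (Fin 3)) (Iio (0 : ℝ)) isOpen_Iio) 1 0 u p ∧ HasWeakSpatialGradientOn (slab (EuclideanSpace ℝ (Fin 3)) (Iio (0 : ℝ)) isOpen_Iio) u G ∧
      typeIBound (Iio (0 : ℝ) ×ˢ univ) u p G < ⊤ ∧ HasTypeIDecay C' u ∧ (HomScar u ∨ AxiScar u)

/-- The zero flow is supported inside every ball (it vanishes everywhere). [folklore] -/
theorem eventuallyInsideBalls_zero :
    EventuallyInsideBalls (0 : ℝ → (EuclideanSpace ℝ (Fin 3)) → (EuclideanSpace ℝ (Fin 3))) :=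
  fun _ _ => ⟨1, one_pos, fun _ _ _ _ => rfl⟩

/-- The zero flow has a homogeneous scar. [folklore] -/
theorem homScar_zero : HomScar (0 : ℝ → (EuclideanSpace ℝ (Fin 3)) → (EuclideanSpace ℝ (Fin 3))) :=
  homScar_of_eventuallyInsideBalls eventuallyInsideBalls_zero

/-- The zero flow has an axisymmetric scar. [folklore] -/
theorem axiScar_zero : AxiScar (0 : ℝ → (EuclideanSpace ℝ (Fin 3)) → (EuclideanSpace ℝ (Fin 3))) :=
  axiScar_of_eventuallyInsideBalls eventuallyInsideBalls_zero

/-- **Without the conclusion's singularity the crux is TRUE outright**: the zero flow (a suitable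
weak solution on the slab with `𝐈 = 0` and decay constant `0`, `zero_mem_apexClass`) has both scar
symmetries.  So the singularity required of the selected profile is load-bearing: without it the
crux carries no content at all. [folklore] -/
theorem symmetricScarExists_without_singularConclusion :
    SymmetricScarExistsWithoutSingularConclusion := by
  intro _ _
  obtain ⟨hsw, hwg, hI, hdec⟩ := zero_mem_apexClass
  exact ⟨0, 0, 0, 0, hsw, hwg, hI, hdec, Or.inl homScar_zero⟩

/-! ### (b) The Navier–Stokes equations of the conclusion -/

/-- The crux with ONLY the Navier–Stokes membership `IsSuitableWeakSolutionOn` dropped from the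
CONCLUSION (weak gradient, `𝐈 < ⊤`, decay, singular origin and scar symmetry all kept). -/
def SymmetricScarExistsWithoutNavierStokesConclusion : Prop :=
  ∀ C : ℝ, (∃ (u : ℝ → (EuclideanSpace ℝ (Fin 3)) → (EuclideanSpace ℝ (Fin 3))) (p : ℝ → (EuclideanSpace ℝ (Fin 3)) → ℝ) (G : ℝ → (EuclideanSpace ℝ (Fin 3)) → (EuclideanSpace ℝ (Fin 3)) →L[ℝ] (EuclideanSpace ℝ (Fin 3))),
      IsSuitableWeakSolutionOn (slab (EuclideanSpace ℝ (Fin 3)) (Iio (0 : ℝ)) isOpen_Iio) 1 0 u p ∧ HasWeakSpatialGradientOn (slab (EuclideanSpace ℝ (Fin 3)) (Iio (0 : ℝ)) isOpen_Iio) u G ∧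
      typeIBound (Iio (0 : ℝ) ×ˢ univ) u p G < ⊤ ∧ HasTypeIDecay C u ∧ IsBackwardSingularPoint u 0) →
    ∃ (C' : ℝ) (u : ℝ → (EuclideanSpace ℝ (Fin 3)) → (EuclideanSpace ℝ (Fin 3))) (p : ℝ → (EuclideanSpace ℝ (Fin 3)) → ℝ) (G : ℝ → (EuclideanSpace ℝ (Fin 3)) → (EuclideanSpace ℝ (Fin 3)) →L[ℝ] (EuclideanSpace ℝ (Fin 3))),
      HasWeakSpatialGradientOn (slab (EuclideanSpace ℝ (Fin 3)) (Iio (0 : ℝ)) isOpen_Iio) u G ∧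
      typeIBound (Iio (0 : ℝ) ×ˢ univ) u p G < ⊤ ∧ HasTypeIDecay C' u ∧ IsBackwardSingularPoint u 0 ∧
      (HomScar u ∨ AxiScar u)

/-- **The kinematic parabolic bump is exactly self-similar** on `t < 0`:
`λ u(λ²t, λx) = u(t,x)` for `u = χ(|x|²/(−t))/√(−t) e₁` and every `λ > 0`. [folklore] -/
theorem nsRescale_apexVelocity_of_neg {lam : ℝ} (hlam : 0 < lam) {t : ℝ} (ht : t < 0)
    (x : EuclideanSpace ℝ (Fin 3)) :
    nsRescale lam ParabolicBump.apexVelocity t x = ParabolicBump.apexVelocity t x := by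
  rw [nsRescale_apply]
  show lam • (ParabolicBump.apexAmp (lam ^ 2 * t) (lam • x) • parasiticDir) =
    ParabolicBump.apexAmp t x • parasiticDir
  rw [smul_smul]
  congr 1
  simp only [ParabolicBump.apexAmp]
  have hnt : 0 < -t := by linarith
  have hl2 : (0 : ℝ) < lam ^ 2 := by positivity
  have hsq : Real.sqrt (-(lam ^ 2 * t)) = lam * Real.sqrt (-t) := by
    rw [show -(lam ^ 2 * t) = lam ^ 2 * (-t) by ring, Real.sqrt_mul (sq_nonneg lam) (-t),
      Real.sqrt_sq hlam.le]
  have harg : ‖lam • x‖ ^ 2 / -(lam ^ 2 * t) = ‖x‖ ^ 2 / -t := by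
    rw [norm_smul, Real.norm_of_nonneg hlam.le, mul_pow,
      show -(lam ^ 2 * t) = lam ^ 2 * (-t) by ring, mul_div_mul_left _ _ hl2.ne']
  rw [harg, hsq]
  have hs : 0 < Real.sqrt (-t) := Real.sqrt_pos.2 hnt
  field_simp

/-- **The bump's support shrinks into the origin**: `u(t,x) = 0` for `‖x‖ ≥ ρ` and `−ρ²/2 < t < 0`
(the cut-off is off where `‖x‖² ≥ 2(−t)`). [folklore] -/
theorem eventuallyInsideBalls_apexVelocity : EventuallyInsideBalls ParabolicBump.apexVelocity := by
  intro ρ hρ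
  refine ⟨ρ ^ 2 / 2, by positivity, fun t ht x hx => ?_⟩
  obtain ⟨ht1, ht2⟩ := ht
  have hsq : ρ ^ 2 ≤ ‖x‖ ^ 2 := pow_le_pow_left₀ hρ.le hx 2
  have h2 : 2 * (-t) ≤ ‖x‖ ^ 2 := by linarith
  show ParabolicBump.apexAmp t x • parasiticDir = 0
  rw [ParabolicBump.apexAmp_eq_zero_of ht2 h2, zero_smul]

/-- Hence the bump has a HOMOGENEOUS scar … [folklore] -/
theorem homScar_apexVelocity : HomScar ParabolicBump.apexVelocity :=
  homScar_of_eventuallyInsideBalls eventuallyInsideBalls_apexVelocity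

/-- … and an AXISYMMETRIC scar (its scar is zero). [folklore] -/
theorem axiScar_apexVelocity : AxiScar ParabolicBump.apexVelocity :=
  axiScar_of_eventuallyInsideBalls eventuallyInsideBalls_apexVelocity

/-- **Without the Navier–Stokes equations in the conclusion the crux is TRUE outright**: the
kinematic bump has a weak spatial gradient on the slab, `𝐈(ℝ³ × ℝ₋) < ⊤` with pressure `0`, the
space–time Type-I bound with constant `3`, a backward-singular origin
(`Literature.Analysis.FluidPDE.ParabolicBump.*`, sibling disprover of `ApexLocalisation`) AND both
scar symmetries.  So inside the full Albritton–Barker function class the conclusion's only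
load-bearing conjunct besides the singularity is the Navier–Stokes system itself; the scar symmetry
costs nothing kinematically. [cite: AlbrittonBarker2019, §1; KNSS2009, (1.6)] -/
theorem symmetricScarExists_without_navierStokesConclusion :
    SymmetricScarExistsWithoutNavierStokesConclusion := fun _ _ =>
  ⟨3, ParabolicBump.apexVelocity, 0, ParabolicBump.apexGradient,
    ParabolicBump.apex_hasWeakSpatialGradientOn, ParabolicBump.typeIBound_apex_lt_top,
    ParabolicBump.apex_hasTypeIDecay, ParabolicBump.apex_isBackwardSingularPoint,
    Or.inl homScar_apexVelocity⟩

/-! ### (c) The sibling support `NoMildScar` without the equations -/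

/-- The sibling support `NoMildScar` (stmt-11723) with its Navier–Stokes hypothesis dropped
(weak gradient, `𝐈 < ⊤`, decay and singularity kept). -/
def NoMildScarWithoutNavierStokes : Prop :=
  ∀ (u : ℝ → EuclideanSpace ℝ (Fin 3) → EuclideanSpace ℝ (Fin 3)) (p : ℝ → EuclideanSpace ℝ (Fin 3) → ℝ) (G : ℝ → EuclideanSpace ℝ (Fin 3) → EuclideanSpace ℝ (Fin 3) →L[ℝ] EuclideanSpace ℝ (Fin 3)) (C : ℝ), HasWeakSpatialGradientOn (slab (EuclideanSpace ℝ (Fin 3)) (Iio (0 : ℝ)) isOpen_Iio) u G → typeIBound (Iio (0 : ℝ) ×ˢ univ) u p G < ⊤ → HasTypeIDecay C u → IsBackwardSingularPoint u 0 → ∀ (σ : EuclideanSpace ℝ (Fin 3) → EuclideanSpace ℝ (Fin 3)) (r : ℝ), 0 < r → MemLp σ 3 (volume.restrict (ball (0 : EuclideanSpace ℝ (Fin 3)) r)) → ¬ (∀ K : Set (EuclideanSpace ℝ (Fin 3)), IsCompact K → (0 : EuclideanSpace ℝ (Fin 3)) ∉ K → Tendsto (fun δ : ℝ => eLpNorm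 (fun z : ℝ × EuclideanSpace ℝ (Fin 3) => u z.1 z.2 - σ z.2) ⊤ (volume.restrict (Ioo (-δ) 0 ×ˢ K))) (𝓝[>] 0) (𝓝 0))

/-- **`NoMildScar` is FALSE without the equations**: the kinematic bump has the ZERO scar `σ = 0`,
which is in `L³(B₁)`.  So the sibling support's content is genuinely dynamical (ESS-type backward
uniqueness from the exterior), not a property of the Type-I function class.
[cite: EscauriazaSereginSverak2003, Thm 1] -/
theorem noMildScar_false_without_navierStokes : ¬ NoMildScarWithoutNavierStokes := by
  intro h
  refine h ParabolicBump.apexVelocity 0 ParabolicBump.apexGradient 3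
    ParabolicBump.apex_hasWeakSpatialGradientOn ParabolicBump.typeIBound_apex_lt_top
    ParabolicBump.apex_hasTypeIDecay ParabolicBump.apex_isBackwardSingularPoint 0 1 one_pos
    MemLp.zero ?_
  intro K hK h0
  have h := sameScar_of_eventuallyInsideBalls eventuallyInsideBalls_apexVelocity
    eventuallyInsideBalls_zero K hK h0
  have hfun : (uncurry ParabolicBump.apexVelocity - uncurry (0 : ℝ → EuclideanSpace ℝ (Fin 3) → EuclideanSpace ℝ (Fin 3))) =
      fun z : ℝ × EuclideanSpace ℝ (Fin 3) => ParabolicBump.apexVelocity z.1 z.2 - (0 : EuclideanSpace ℝ (Fin 3) → EuclideanSpace ℝ (Fin 3)) z.2 := by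
    funext z
    simp [uncurry]
  rwa [hfun] at h

/-! ### (d) The decay constant of the conclusion is NOT load-bearing relative to (L) -/

/-- The crux with the Type-I decay dropped from the CONCLUSION (the selected profile need only be a
singular suitable weak solution with `𝐈 < ⊤` and a symmetric scar). -/
def SymmetricScarExistsWithoutDecayConclusion : Prop :=
  ∀ C : ℝ, (∃ (u : ℝ → (EuclideanSpace ℝ (Fin 3)) → (EuclideanSpace ℝ (Fin 3))) (p : ℝ → (EuclideanSpace ℝ (Fin 3)) → ℝ) (G : ℝ → (EuclideanSpace ℝ (Fin 3)) → (EuclideanSpace ℝ (Fin 3)) →L[ℝ] (EuclideanSpace ℝ (Fin 3))),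
      IsSuitableWeakSolutionOn (slab (EuclideanSpace ℝ (Fin 3)) (Iio (0 : ℝ)) isOpen_Iio) 1 0 u p ∧ HasWeakSpatialGradientOn (slab (EuclideanSpace ℝ (Fin 3)) (Iio (0 : ℝ)) isOpen_Iio) u G ∧
      typeIBound (Iio (0 : ℝ) ×ˢ univ) u p G < ⊤ ∧ HasTypeIDecay C u ∧ IsBackwardSingularPoint u 0) →
    ∃ (u : ℝ → (EuclideanSpace ℝ (Fin 3)) → (EuclideanSpace ℝ (Fin 3))) (p : ℝ → (EuclideanSpace ℝ (Fin 3)) → ℝ) (G : ℝ → (EuclideanSpace ℝ (Fin 3)) → (EuclideanSpace ℝ (Fin 3)) →L[ℝ] (EuclideanSpace ℝ (Fin 3))),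
      IsSuitableWeakSolutionOn (slab (EuclideanSpace ℝ (Fin 3)) (Iio (0 : ℝ)) isOpen_Iio) 1 0 u p ∧ HasWeakSpatialGradientOn (slab (EuclideanSpace ℝ (Fin 3)) (Iio (0 : ℝ)) isOpen_Iio) u G ∧
      typeIBound (Iio (0 : ℝ) ×ˢ univ) u p G < ⊤ ∧ IsBackwardSingularPoint u 0 ∧ (HomScar u ∨ AxiScar u)

/-- The crux implies the decay-free weakening (forget the constant). [folklore] -/
theorem symmetricScarExistsWithoutDecayConclusion_of_symmetricScarExists (hS : SymmetricScarExists) :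
    SymmetricScarExistsWithoutDecayConclusion := by
  intro C hex
  obtain ⟨-, u, p, G, hsw, hwg, hI, -, hsing, hsym⟩ := hS C hex
  exact ⟨u, p, G, hsw, hwg, hI, hsing, hsym⟩

/-- A refutation of the decay-free weakening still exhibits a local Type-I singularity (its
antecedent is the crux's). [cite: AlbrittonBarker2019, Thm 1.1] -/
theorem localTypeISingularityExists_of_not_withoutDecayConclusion
    (h : ¬ SymmetricScarExistsWithoutDecayConclusion) : LocalTypeISingularityExists := by
  by_contra hno
  refine h fun C hex => ?_
  obtain ⟨u, p, G, hsw, hwg, hI, -, hsing⟩ := hex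
  exact absurd (localTypeISingularityExists_of_slabProfile hsw hwg hI hsing) hno

/-- … and so does any instantiation of its conclusion. [cite: AlbrittonBarker2019, Thm 1.1] -/
theorem localTypeISingularityExists_of_withoutDecayConclusion
    (h : SymmetricScarExistsWithoutDecayConclusion)
    (hex : ∃ (C : ℝ) (u : ℝ → (EuclideanSpace ℝ (Fin 3)) → (EuclideanSpace ℝ (Fin 3))) (p : ℝ → (EuclideanSpace ℝ (Fin 3)) → ℝ) (G : ℝ → (EuclideanSpace ℝ (Fin 3)) → (EuclideanSpace ℝ (Fin 3)) →L[ℝ] (EuclideanSpace ℝ (Fin 3))),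
      IsSuitableWeakSolutionOn (slab (EuclideanSpace ℝ (Fin 3)) (Iio (0 : ℝ)) isOpen_Iio) 1 0 u p ∧ HasWeakSpatialGradientOn (slab (EuclideanSpace ℝ (Fin 3)) (Iio (0 : ℝ)) isOpen_Iio) u G ∧
      typeIBound (Iio (0 : ℝ) ×ˢ univ) u p G < ⊤ ∧ HasTypeIDecay C u ∧ IsBackwardSingularPoint u 0) :
    LocalTypeISingularityExists := by
  obtain ⟨C, hexC⟩ := hex
  obtain ⟨u, p, G, hsw, hwg, hI, hsing, -⟩ := h C hexC
  exact localTypeISingularityExists_of_slabProfile hsw hwg hI hsing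

/-- **Relative to the (L)-world the conclusion's decay is not load-bearing**: under
`¬ LocalTypeISingularityExists` the crux and its decay-free weakening are both true (vacuously), hence
equivalent.  Contrast (a), (b): dropping the singularity or the equations from the conclusion makes the
statement true BY CONSTRUCTION, in every world. [cite: AlbrittonBarker2019, Thm 1.1] -/
theorem symmetricScarExistsWithoutDecayConclusion_iff_of_not_localTypeISingularityExists
    (hno : ¬ LocalTypeISingularityExists) :
    SymmetricScarExistsWithoutDecayConclusion ↔ SymmetricScarExists := by
  refine ⟨fun _ => symmetricScarExists_of_not_localTypeISingularityExists hno,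
    symmetricScarExistsWithoutDecayConclusion_of_symmetricScarExists⟩

end ConclusionLoadBearing

end Summit.NavierStokesRegularity.NavierStokesRegularity.Theorems.SymmetricScarExists.Negative
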